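import Summits.ABC.IUTFork.Cor312SettingDHVol
import Summits.ABC.IUTFork.Cor312VolumesPadicLatticeBounds
import Summits.ABC.IUTFork.Cor312StatementStability
import HarnessLib

/-!
# [IUTchIII] Corollary 3.12, statement — "`−|log(Θ)|` is finite" LOCALLY for the real setting with the verbatim
# volumes: `HullDefined` at EVERY `(j, v_ℚ)` from two transparent conditions on the Θ-boxes

Record-only file (D-0012) of the abc-iut cell (Cor. 3.12 sub-crew, seat abc-iut-c312-5, gen 3; D-0067 TEAM A row
A-0 «finiteness + BridgeHyps at the real setting» — the `ThetaFinite` leftover named by gen 2 for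
`Real.bridgeHyps_settingDHVol`, REAL-INSTANCE half; the generic half over `Setting.ofComparison` is
abc-iut-c312-7's `Cor312ThetaFiniteReal`); TAKES NO SIDE. The first clause "`−|log(Θ)| ∈ ℝ`" of [IUTchIII]
Cor. 3.12 (kurims `paper:url-4b091feeb646` p. 174 l. 16) is obtained in the proof's opening paragraph (p. 175
l. 2–4): "one concludes easily from the [easily verified] compactness of the `^{1,∘}𝒰_{j,v_ℚ}` … that the quantity
`−|log(Θ)|` is finite". For c312-5's setting `Real.settingDHVol` (`Cor312SettingDHVol`: c312-7's
`Setting.ofComparison` over the real Dupuy–Hilado-level log-shells of `F` WITH THE VERBATIM container of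
[IUTchIII] Rmk. 3.1.1 (ii)(iii), field-factor comparison `factorMapDH`, Θ-boxes a BINDER `thetaBox`) this file
PROVES c312-7's `HullDefined j v_ℚ` — the union of ALL possible images of the Θ-pilot object at `(j, v_ℚ)` is
relatively compact and admits its holomorphic hull, so the local Θ-volume `thetaLocal j v_ℚ` is a real number:

* at `v_ℚ = ∞` UNCONDITIONALLY (`hullDefined_settingDHVol_inl`: the field-factor index there is empty — the
  modelling choice of `Cor312VolumesRealAssembly`'s trivial archimedean container);
* at `v_ℚ = p` from TWO conditions on the Θ-boxes only (`hullDefined_settingDHVol_inr`): the union over `m`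
  (the (Ind3)-enlargement) of the boxes `thetaBox m` of the Θ-pilot object is BOUNDED (Dupuy–Hilado (4.10):
  "we assume a bound on `O_𝕃(−P_Θ)^{Ind3}`") and NONDEGENERATE (no field factor vanishes identically on it).
  Mechanism (Dupuy–Hilado §4 intro/§4.7/§4.9, KERNEL-CHECKED on the real prime packets in c312-5's
  `Cor312VolumesPadicLattice(Bounds)`): the bounded union is absorbed by a log-shell lattice `Π_{v⃗} c·I_{v⃗}`,
  which every (Ind1)/(Ind2) generator FIXES, so the whole indeterminacy orbit stays inside it (c312-7's
  `hullDefined_of_stable` with `W = e⁻¹(Π_{v⃗} c·I_{v⃗})`), and the lattice is bounded.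
Also: `thetaRegion3_settingDHVol` / `image_thetaRegion3_settingDHVol_inr` (the (Ind3)-region IS `e⁻¹(⋃ₘ boxes)`,
with image `⋃ₘ boxes` at a prime) and `thetaLocal_ne_top_settingDHVol_*`.
[claim: Mochizuki2012, status: disputed] for the quoted sentences; [cite: DupuyHilado2025, §4 (intro), §4.10].
Deliberately NOT here: the value of the hull volume at good primes, `ThetaFinite`, `BridgeHyps` (companion
`Cor312ThetaFiniteDHVol`), any judgement.
-/

noncomputable section

open Set Function NumberField IsDedekindDomain Bornology
open scoped Pointwise

namespace Summit.ABC

namespace IUTFork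

namespace Thm311

namespace Real

open Cor312 Cor312Vol Literature.IUT.LogThetaLattice Literature.IUT.LogVolume

variable {F : Type} [Field F] [NumberField F] (X : PilotData F) {logv : PadicLogs F} (hlog : LogvAnalytic logv)

section Setting

variable (M : Type) [Field M] [NumberField M]
  (archPk : ∀ (j : (thetaIndex X).Label) (vQ : (thetaIndex X).VQ), Set ((logShellsDH X logv).Packet j vQ))
  (archSub : ∀ (j : (thetaIndex X).Label) (v : (thetaIndex X).V),
    Set ((logShellsDH X logv).Packet j ((thetaIndex X).over v)))
  (Ψ : ℤ → ∀ v : (thetaIndex X).V, v ∈ (thetaIndex X).Vbad → Set ((logShellsDH X logv).StarPacket v))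
  (act : ℤ → ∀ v : (thetaIndex X).V, v ∈ (thetaIndex X).Vbad →
    (logShellsDH X logv).StarPacket v → Module.End ℚ ((logShellsDH X logv).StarPacket v))
  (Mmod : ℤ → ∀ j : (thetaIndex X).LabelStar, Set ((logShellsDH X logv).GlobalPacket j.1))
  (region : ℤ → ∀ j : (thetaIndex X).LabelStar, FinDivisor M → ∀ vQ : (thetaIndex X).VQ,
    Set ((logShellsDH X logv).Packet j.1 vQ))
  (n : ℤ) {HT : Type} {LogLink : HT → HT → Type} {IsFull : ∀ {s t : HT}, LogLink s t → Prop}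
  (lat : LGPGaussianLogThetaLattice LogLink IsFull)
  {Frd : Type} {IsoF : Frd → Frd → Type} {Ob : Frd → Type} {realify : Frd → Frd} {Strip : Type}
  {IsoS : Strip → Strip → Type} {Mv : ∀ v : (thetaIndex X).V, v ∈ (thetaIndex X).Vbad → Type}
  [∀ v h, Monoid (Mv v h)]
  (sig : GlobalLGPFrobenioidSignature (thetaIndex X).lstar (thetaIndex X).V (· ∈ (thetaIndex X).Vbad)
    Frd IsoF Ob realify Strip IsoS Mv)
  (split : SplittingMonoids Mv) {ObΔ : Type} {N : ∀ v : (thetaIndex X).V, v ∈ (thetaIndex X).Vbad → Type}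
  [∀ v h, Monoid (N v h)] (qData : QPilotData ObΔ N)
  (thetaBox : ℤ → Ob sig.Clgp → ∀ (j : (thetaIndex X).Label) (vQ : (thetaIndex X).VQ),
    Set (∀ s : factorIdxDH X hlog j vQ, factorFieldDH X hlog j vQ s))
  (qCentre : ObΔ → ∀ (j : (thetaIndex X).Label) (vQ : (thetaIndex X).VQ),
    ∀ s : factorIdxDH X hlog j vQ, factorFieldDH X hlog j vQ s)
  (hq : ∀ j vQ s, qCentre (qPilotObject qData) j vQ s ≠ 0)
  (hfin : ∀ j : (thetaIndex X).Label, (Function.support fun vQ =>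
    ((situationDHVol X hlog M archPk archSub Ψ act Mmod region).D n).logvol j vQ
      (factorMapDH X hlog j vQ ⁻¹' hullSet (factorFieldDH X hlog j vQ) (qCentre (qPilotObject qData) j vQ))).Finite)

/-! ## 1. The (Ind3)-region of the assembled setting is `e⁻¹(⋃ₘ Θ-boxes)` -/

/-- The (Ind3)-enlarged Θ-region of `settingDHVol` at `(j, v_ℚ)` IS the preimage under the field-factor comparison
of the union over `m` of the Θ-boxes of the Θ-pilot object (c312-7 `ofComparison_thetaRegion`, per `m`).
[folklore] -/
theorem thetaRegion3_settingDHVol (j : (thetaIndex X).Label) (vQ : (thetaIndex X).VQ) :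
    (settingDHVol X hlog M archPk archSub Ψ act Mmod region n lat sig split qData thetaBox qCentre hq
      hfin).thetaRegion3 j vQ =
      factorMapDH X hlog j vQ ⁻¹' ⋃ m : ℤ, thetaBox m (thetaPilotObject sig split) j vQ := by
  rw [Set.preimage_iUnion]
  rfl

/-- At a prime the field-factor comparison `factorMapDH` IS `factorCoords ∘ e` of c312-5's presentation
(`Cor312VolumesPadicLatticeBounds`). [folklore] -/
theorem factorMapDH_inr (j : (thetaIndex X).Label) (pp : Nat.Primes) :
    factorMapDH X hlog j (.inr pp) = fun x =>
      haveI : Fact (pp : ℕ).Prime := ⟨pp.2⟩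
      (presAt X hlog pp).factorCoords j ((presAt X hlog pp).comparison j x) :=
  rfl

/-- At a prime the field-factor comparison is ONTO (`e` onto, `ψ_{v⃗}` bijective). [folklore] -/
theorem factorMapDH_inr_surjective (j : (thetaIndex X).Label) (pp : Nat.Primes) :
    Function.Surjective (factorMapDH X hlog j (.inr pp)) := by
  haveI : Fact (pp : ℕ).Prime := ⟨pp.2⟩
  rw [factorMapDH_inr]
  exact ((presAt X hlog pp).factorCoords_surjective j).comp ((presAt X hlog pp).comparison_surjective j)

/-- At a prime, the image of the (Ind3)-region under the field-factor comparison IS the union of the Θ-boxes.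
[folklore] -/
theorem image_thetaRegion3_settingDHVol_inr (j : (thetaIndex X).Label) (pp : Nat.Primes) :
    factorMapDH X hlog j (.inr pp) ''
        (settingDHVol X hlog M archPk archSub Ψ act Mmod region n lat sig split qData thetaBox qCentre hq
          hfin).thetaRegion3 j (.inr pp) =
      ⋃ m : ℤ, thetaBox m (thetaPilotObject sig split) j (.inr pp) := by
  rw [thetaRegion3_settingDHVol]
  exact Set.image_preimage_eq _ (factorMapDH_inr_surjective X hlog j pp)

/-! ## 2. The archimedean place: `HullDefined` unconditionally (empty field-factor index) -/

/-- **`HullDefined` at `v_ℚ = ∞`, UNCONDITIONALLY**: the field-factor index of `settingDHVol` at the archimedean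
place is empty (modelling choice of `Cor312VolumesRealAssembly`), so every subset of the one-point real packet is
bounded and vacuously nondegenerate. [claim: Mochizuki2012, status: disputed] -/
theorem hullDefined_settingDHVol_inl (j : (thetaIndex X).Label) (u : Unit) :
    (settingDHVol X hlog M archPk archSub Ψ act Mmod region n lat sig split qData thetaBox qCentre hq
      hfin).HullDefined j (.inl u) := by
  refine ⟨isBounded_iff_forall_norm_le.2 ⟨0, fun z _ => (pi_norm_le_iff_of_nonneg le_rfl).2 fun s => s.elim⟩,
    fun s => s.elim⟩

/-! ## 3. A prime: `HullDefined` from BOUNDED and NONDEGENERATE Θ-boxes -/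

/-- **`HullDefined` at `v_ℚ = p` from two conditions on the Θ-boxes**: if the union over `m` of the Θ-boxes of the
Θ-pilot object at `(j, p)` is BOUNDED (Dupuy–Hilado (4.10)) and NONDEGENERATE, then the union of ALL possible
images of the Θ-pilot object at `(j, p)` — the whole (Ind1)/(Ind2)-orbit of the (Ind3)-region — is relatively
compact and admits its holomorphic hull ([IUTchIII] proof of Cor. 3.12, p. 175 l. 2–4 "compactness of the
`^{1,∘}𝒰_{j,v_ℚ}`"). PROOF: the bounded union is absorbed by a log-shell lattice `Π_{v⃗} c·I_{v⃗}`
(`exists_latticeF_of_norm_le`), every (Ind1)/(Ind2) generator fixes `e⁻¹(Π_{v⃗} c·I_{v⃗})` (`family_image_latticePk`;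
Dupuy–Hilado §4: "fixes the lattice", "also preserve this lattice"), so c312-7's `hullDefined_of_stable` applies
with the BOUNDED stable set `W = e⁻¹(Π_{v⃗} c·I_{v⃗})`. [claim: Mochizuki2012, status: disputed] -/
theorem hullDefined_settingDHVol_inr (j : (thetaIndex X).Label) (pp : Nat.Primes)
    (hbdd : Bornology.IsBounded (⋃ m : ℤ, thetaBox m (thetaPilotObject sig split) j (.inr pp)))
    (hnd : IsNondegenerate (factorFieldDH X hlog j (.inr pp))
      (⋃ m : ℤ, thetaBox m (thetaPilotObject sig split) j (.inr pp))) :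
    (settingDHVol X hlog M archPk archSub Ψ act Mmod region n lat sig split qData thetaBox qCentre hq
      hfin).HullDefined j (.inr pp) := by
  haveI : Fact (pp : ℕ).Prime := ⟨pp.2⟩
  -- the bounded union of boxes is absorbed by a lattice `Π_{v⃗} c·I_{v⃗}`
  obtain ⟨R, hR⟩ := isBounded_iff_forall_norm_le.1 hbdd
  obtain ⟨c, -, hcR⟩ := (presAt X hlog pp).exists_latticeF_of_norm_le (j := j) R
  have hsub : (⋃ m : ℤ, thetaBox m (thetaPilotObject sig split) j (.inr pp)) ⊆
      (presAt X hlog pp).latticeF j c :=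
    fun z hz => hcR z fun s => (norm_le_pi_norm z s).trans (hR z hz)
  -- c312-7's criterion with `W = e⁻¹(Π_{v⃗} c·I_{v⃗})`
  refine Setting.hullDefined_of_stable n lat sig split qData
    (realPiecesDH X hlog M archPk archSub Ψ act Mmod region thetaBox qCentre) hq
    (hadm_DH X hlog M archPk archSub Ψ act Mmod region n) hfin j (.inr pp) ((presAt X hlog pp).latticePk j c)
    (fun Φ hΦ => (presAt X hlog pp).family_image_latticePk hΦ j c) ?_ ?_ ?_
  · -- the (Ind3)-region lies in `W`
    intro x hx
    have hx' : factorMapDH X hlog j (.inr pp) x ∈ ⋃ m : ℤ, thetaBox m (thetaPilotObject sig split) j (.inr pp) := by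
      change x ∈ (settingDHVol X hlog M archPk archSub Ψ act Mmod region n lat sig split qData thetaBox qCentre hq
        hfin).thetaRegion3 j (.inr pp) at hx
      rw [thetaRegion3_settingDHVol] at hx
      exact hx
    have h2 := hsub hx'
    rw [← (presAt X hlog pp).preimage_latticeF_comparison c]
    exact h2
  · -- `e '' W = latticeF c` is bounded
    obtain ⟨R', hR'0, hR'⟩ := (presAt X hlog pp).exists_norm_le_of_mem_latticeF (j := j) c
    have himg : factorMapDH X hlog j (.inr pp) '' (presAt X hlog pp).latticePk j c =
        (presAt X hlog pp).latticeF j c :=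
      (presAt X hlog pp).image_latticePk c
    refine isBounded_iff_forall_norm_le.2 ⟨R', fun z hz => (pi_norm_le_iff_of_nonneg hR'0).2 (hR' z ?_)⟩
    rw [← himg]
    exact hz
  · -- the image of the (Ind3)-region is the union of the boxes, nondegenerate by hypothesis
    change IsNondegenerate (factorFieldDH X hlog j (.inr pp)) (factorMapDH X hlog j (.inr pp) ''
      (settingDHVol X hlog M archPk archSub Ψ act Mmod region n lat sig split qData thetaBox qCentre hq
        hfin).thetaRegion3 j (.inr pp))
    rw [image_thetaRegion3_settingDHVol_inr]
    exact hnd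

/-! ## 4. Consequences: `HullDefined` everywhere, `thetaLocal ≠ ⊤` -/

/-- **`HullDefined` at every `(j, v_ℚ)`** from bounded nondegenerate Θ-boxes at the primes.
[claim: Mochizuki2012, status: disputed] -/
theorem hullDefined_settingDHVol (j : (thetaIndex X).Label)
    (hbdd : ∀ pp : Nat.Primes, Bornology.IsBounded (⋃ m : ℤ, thetaBox m (thetaPilotObject sig split) j (.inr pp)))
    (hnd : ∀ pp : Nat.Primes, IsNondegenerate (factorFieldDH X hlog j (.inr pp))
      (⋃ m : ℤ, thetaBox m (thetaPilotObject sig split) j (.inr pp))) :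
    ∀ vQ : (thetaIndex X).VQ,
      (settingDHVol X hlog M archPk archSub Ψ act Mmod region n lat sig split qData thetaBox qCentre hq
        hfin).HullDefined j vQ
  | .inl u => hullDefined_settingDHVol_inl X hlog M archPk archSub Ψ act Mmod region n lat sig split qData
      thetaBox qCentre hq hfin j u
  | .inr pp => hullDefined_settingDHVol_inr X hlog M archPk archSub Ψ act Mmod region n lat sig split qData
      thetaBox qCentre hq hfin j pp (hbdd pp) (hnd pp)

/-- **The local Θ-volume is a real number at every `(j, v_ℚ)`** (not `+∞`: "`−|log(Θ)|` is finite" locally).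
[claim: Mochizuki2012, status: disputed] -/
theorem thetaLocal_ne_top_settingDHVol (j : (thetaIndex X).Label)
    (hbdd : ∀ pp : Nat.Primes, Bornology.IsBounded (⋃ m : ℤ, thetaBox m (thetaPilotObject sig split) j (.inr pp)))
    (hnd : ∀ pp : Nat.Primes, IsNondegenerate (factorFieldDH X hlog j (.inr pp))
      (⋃ m : ℤ, thetaBox m (thetaPilotObject sig split) j (.inr pp))) (vQ : (thetaIndex X).VQ) :
    (settingDHVol X hlog M archPk archSub Ψ act Mmod region n lat sig split qData thetaBox qCentre hq
      hfin).thetaLocal j vQ ≠ ⊤ := by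
  unfold Setting.thetaLocal
  rw [if_pos (hullDefined_settingDHVol X hlog M archPk archSub Ψ act Mmod region n lat sig split qData thetaBox
    qCentre hq hfin j hbdd hnd vQ)]
  exact WithTop.coe_ne_top

/-- The hull `^{n,∘}𝒰_{j,v_ℚ}` of the union of the possible images is then an ADMISSIBLE region of the verbatim
container (c312-7 `thetaHull_adm`). [claim: Mochizuki2012, status: disputed] -/
theorem thetaHull_adm_settingDHVol (j : (thetaIndex X).Label)
    (hbdd : ∀ pp : Nat.Primes, Bornology.IsBounded (⋃ m : ℤ, thetaBox m (thetaPilotObject sig split) j (.inr pp)))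
    (hnd : ∀ pp : Nat.Primes, IsNondegenerate (factorFieldDH X hlog j (.inr pp))
      (⋃ m : ℤ, thetaBox m (thetaPilotObject sig split) j (.inr pp))) (vQ : (thetaIndex X).VQ) :
    ((situationDHVol X hlog M archPk archSub Ψ act Mmod region).D n).Adm j vQ
      ((settingDHVol X hlog M archPk archSub Ψ act Mmod region n lat sig split qData thetaBox qCentre hq
        hfin).thetaHull j vQ) :=
  (settingDHVol X hlog M archPk archSub Ψ act Mmod region n lat sig split qData thetaBox qCentre hq
    hfin).thetaHull_adm (hullDefined_settingDHVol X hlog M archPk archSub Ψ act Mmod region n lat sig split qData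
      thetaBox qCentre hq hfin j hbdd hnd vQ)

end Setting

end Real

end Thm311

end IUTFork

end Summit.ABC

end
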